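import Summits.CriticalPhenomena.PercolationContinuityZ3.Theses.PercHyperscalingGluing
import Summits.CriticalPhenomena.PercolationContinuityZ3.Theorems.PercNonProliferationFreeBoxSparse
import Summits.CriticalPhenomena.PercolationContinuityZ3.Theorems.FreeBoxSparse.Negative.CentredForms
import HarnessLib

/-!
# `PercHyperscalingGluing.FreeBoxShattering` (stmt-CriticalPhenomena-4644) — SETTLED after continuity

Item `stmt-CriticalPhenomena-4644` of route `CriticalPhenomena/PercHyperscalingGluing` (crux r3, 'free-box shattering at
`p_c`'): `F_r := |Λ_r|⁻¹ Σ_{x∈Λ_r} P_{p_c}(0 ↔ x inside Λ_r) → 0` as `r → ∞` on `ℤ³`.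

The tree already holds (a) the twin crux `PercNonProliferation.FreeBoxSparse` (stmt-4445, pair form
`|Λ_n|⁻² Σ_{x,y∈Λ_n} P_{p_c}(x ↔ y in Λ_n) → 0`), PROVED from p205010
(`PercNonProliferationFreeBoxSparse.freeBoxSparse_proof`, lead gen 28), and (b) the refuter's bookkeeping
`FreeBoxSparse.Negative.freeBoxSparse_iff_hyperscalingGluing_freeBoxShattering` ('one statement, three names':
re-rooting the centre over `Λ_r`, `F(r) ≤ 64·FA₂(2r)` and `FA₂(n) ≤ 8·F(2n)`).  This file composes them: the item
holds.  (A direct proof from the one-arm bound — `P(0 ↔ x in Λ_r) ≤ P_{p_c}(0 ↔ ∂Λ_{|x|∞}) → θ(p_c) = 0` — is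
given for the third twin `PercHollowCells.FreeBoxShattering`, stmt-5836, in
`PercHollowCellsFreeBoxShattering.lean`.)  No rate is claimed.

builds on p205010 (kernel theorem, internal audit signed; external expert review pending) — USED (through
`freeBoxSparse_proof`, i.e. `CSH.percolationContinuityZ3_holds`).  RSW3 lane, prover P2 gen 32
(prover-prim-rsw3-p2-g32-0), METHOD '3D RSW-lite from continuity'.
References: T. Hutchcroft (2022), arXiv:2202.07634 p. 5 [Hutchcroft2022]; G. Kozma, N. Nitzan (2024) [KozmaNitzan2024].
-/

noncomputable section

namespace Summit.CriticalPhenomena.PercolationContinuityZ3.Theorems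

namespace HyperscalingGluingFreeBoxShattering

/-- **`PercHyperscalingGluing.FreeBoxShattering` (stmt-CriticalPhenomena-4644), settled**: the centred free-box
shattering statement follows from its proved pair-form twin `PercNonProliferation.FreeBoxSparse` (stmt-4445,
p205010) by the tree's equivalence `freeBoxSparse_iff_hyperscalingGluing_freeBoxShattering`.
[cite: KozmaNitzan2024, Thm. 6 with Conj. 3 (p. 15)] -/
theorem freeBoxShattering_proof :
    Summit.CriticalPhenomena.PercolationContinuityZ3.Theses.PercHyperscalingGluing.FreeBoxShattering :=
  FreeBoxSparse.Negative.freeBoxSparse_iff_hyperscalingGluing_freeBoxShattering.mp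
    PercNonProliferationFreeBoxSparse.freeBoxSparse_proof

end HyperscalingGluingFreeBoxShattering

end Summit.CriticalPhenomena.PercolationContinuityZ3.Theorems

end
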